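import Summits.NavierStokesRegularity.NavierStokesRegularity.Theorems.EulerZoomLiouvillePowerGaugeEulerLiouvilleWeakRenormalizedTransport

/-!
# RENORMALISED similarity-Bernoulli transport IN THE WEAK CLASS, III: member level — crux hypotheses verbatim
# (crux `EulerZoomLiouville.PowerGaugeEulerLiouville` = stmt-NavierStokesRegularity-19832, line `birth`, open stub `stub_selfSimilarWeakRest`)

Width seat `ns-ezl-w1` (g7) under the crux LEAD, cell ns-regularity-ideate.  Member level of `…WeakRenormalizedTransport`:
the profile data of a past-exact / exactly self-similar member of Seregin's power-gauged class
(`Past.profileData_of_past`: `V ∈ L⁶_loc` with whole-space weak gradient `G ∈ L²_loc`, `P ∈ L^{3/2}_loc`, weak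
divergence-freeness, the weak profile equation) feed g6's weak pressure-gradient law and Lamb form
(`WeakPressure.hasWeakFDerivOn_pressure`, `WeakBernoulli.hasWeakFDerivOn_bernoulli`) and then the profile-level theorems:

* **`WeakRenormalized.renormalized_transport_law_of_past` / `_of_selfSimilar`** — crux hypotheses verbatim (`0 < ρ ≤ ½`,
  `γ = 1/(2+ρ)`), exact self-similarity about `(T, x₀)` before `T₁` / about the origin: for every `β ∈ C¹(ℝ)` with bounded
  derivative and every test function `θ`, `∫β(ℋ)⟪W,∇θ⟫ = −3γ∫θβ(ℋ) + (1−2γ)∫θβ′(ℋ)|W|²`;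
* **`WeakRenormalized.highSet_transport_ineq_of_past` / `_of_selfSimilar`** — for every level `h` and every nonnegative
  test function `θ`: `−3γ ∫_{ℋ>h} θ ≤ ∫_{ℋ>h} ⟪W, ∇θ⟫` — THE BERNOULLI HIGH SETS OF A GENUINELY WEAK EXACTLY SELF-SIMILAR
  MEMBER ARE BACKWARD-INVARIANT in the sense of distributions (`div(𝟙_{ℋ>h}W) ≤ 𝟙_{ℋ>h} div W`), with NO regularity of
  the profile — the Eulerian substitute, in the stratum of `stub_selfSimilarWeakRest`, for the Lagrangian monotonicity of
  `ℋ` from which every needle argument of the `C²` stratum starts.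

WHAT THIS IS NOT: not NS, not E, not the stub — weak-class TOOLS (`--supports` stmt-19832); no summit statement is proved
here; 19832 OPEN. [folklore; cf. ConstantinIgnatovaVicol2026Putative §3.4.3 (3.29)–(3.33)]
-/

noncomputable section

set_option linter.dupNamespace false
-- nested operator types (`innerSL … ∘L …`)
set_option maxSynthPendingDepth 3

open MeasureTheory Set Filter Topology Metric Function TopologicalSpace
open scoped ENNReal NNReal RealInnerProductSpace ContDiff

namespace Summit.NavierStokesRegularity.NavierStokesRegularity.Theorems.PowerGaugeEulerLiouville

open Literature.Analysis Literature.Analysis.FunctionSpaces Literature.Analysis.FluidPDE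

namespace WeakRenormalized

/-! ## Bookkeeping: a lintegral growth bound in Bochner form -/

/-- `∫_{B_R} ‖V‖² = (∫⁻_{B_R} ‖V‖ₑ²).toReal` for `V ∈ L²(B_R)`, hence a lintegral bound passes to the Bochner integral. [folklore] -/
theorem setIntegral_norm_sq_le_of_lintegral_le {V : EuclideanSpace ℝ (Fin 3) → EuclideanSpace ℝ (Fin 3)} {R c : ℝ} (hc : 0 ≤ c)
    (hV2 : MemLp V 2 (volume.restrict (ball (0 : EuclideanSpace ℝ (Fin 3)) R)))
    (h : ∫⁻ x in ball (0 : EuclideanSpace ℝ (Fin 3)) R, ‖V x‖ₑ ^ 2 ≤ ENNReal.ofReal c) :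
    ∫ x in ball (0 : EuclideanSpace ℝ (Fin 3)) R, ‖V x‖ ^ 2 ≤ c := by
  have hi : Integrable (fun x => ‖V x‖ ^ 2) (volume.restrict (ball (0 : EuclideanSpace ℝ (Fin 3)) R)) :=
    (memLp_two_iff_integrable_sq_norm hV2.1).1 hV2
  rw [integral_eq_lintegral_of_nonneg_ae (Eventually.of_forall fun x => by positivity) hi.1]
  have e : ∫⁻ x in ball (0 : EuclideanSpace ℝ (Fin 3)) R, ENNReal.ofReal (‖V x‖ ^ 2) =
      ∫⁻ x in ball (0 : EuclideanSpace ℝ (Fin 3)) R, ‖V x‖ₑ ^ 2 :=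
    lintegral_congr fun x => by rw [← ofReal_norm, ENNReal.ofReal_pow (norm_nonneg _)]
  rw [e]
  exact (ENNReal.toReal_mono ENNReal.ofReal_ne_top h).trans (by rw [ENNReal.toReal_ofReal hc])

/-! ## The weak profile package of a past-exact member -/

/-- **The renormalisation data of a past-exact self-similar class member** (`0 < ρ ≤ ½`, `γ = 1/(2+ρ)`): crux hypotheses
verbatim + exact self-similarity about `(T, x₀)` for `τ < T₁` (`T₁ ≤ 0`, `T₁ ≤ T`) ⇒ a profile gradient `G` with
`V ∈ L⁶(B_r)`, `G ∈ L²(B_r)`, `P ∈ L^{3/2}(B_r)` (all `r`), `V` weakly divergence free, the Lamb form of `∇ℋ` on `ℝ³`, and the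
`A`-growth in the crude Bochner form `∫_{B_L}‖V‖² ≤ c_A L³` for `L ≥ max (2 − T₁) 1` (from `∫_{B_L}‖V‖² ≤ C L^{1−2ρ}`)
(`Past.profileData_of_past` + `WeakPressure.hasWeakFDerivOn_pressure` + `WeakBernoulli.hasWeakFDerivOn_bernoulli`). [folklore] -/
theorem renormalizationData_of_past {ρ : ℝ} (hρ : 0 < ρ) (hρh : ρ ≤ 1 / 2)
    {T T₁ : ℝ} (hT₁ : T₁ ≤ 0) (hTT₁ : T₁ ≤ T) (x₀ : EuclideanSpace ℝ (Fin 3))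
    {u : ℝ → EuclideanSpace ℝ (Fin 3) → EuclideanSpace ℝ (Fin 3)} {p : ℝ → EuclideanSpace ℝ (Fin 3) → ℝ}
    {H : ℝ → EuclideanSpace ℝ (Fin 3) → EuclideanSpace ℝ (Fin 3) →L[ℝ] EuclideanSpace ℝ (Fin 3)} {c : ℝ≥0}
    (hsw : IsSuitableWeakSolutionOn (slab (EuclideanSpace ℝ (Fin 3)) (Iio 0) isOpen_Iio) 0 0 u p)
    (hH : HasWeakSpatialGradientOn (slab (EuclideanSpace ℝ (Fin 3)) (Iio 0) isOpen_Iio) u H)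
    (hgauge : ∀ a : ℝ, 0 < a →
      ENNReal.ofReal (a ^ (2 * ρ)) * cknA a (0 : ℝ × EuclideanSpace ℝ (Fin 3)) u +
          ENNReal.ofReal (a ^ ρ) * cknE a (0 : ℝ × EuclideanSpace ℝ (Fin 3)) H +
        ENNReal.ofReal (a ^ (2 * ρ)) * cknD a (0 : ℝ × EuclideanSpace ℝ (Fin 3)) p ≤ (c : ℝ≥0∞))
    {V : EuclideanSpace ℝ (Fin 3) → EuclideanSpace ℝ (Fin 3)} {P : EuclideanSpace ℝ (Fin 3) → ℝ}
    (hu : ∀ τ : ℝ, τ < T₁ → u τ = fun x => selfSimilarCollapse (1 / (2 + ρ)) T V τ (x - x₀))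
    (hp : ∀ τ : ℝ, τ < T₁ → p τ = fun x => selfSimilarCollapsePressure (1 / (2 + ρ)) T P τ (x - x₀)) :
    ∃ G : EuclideanSpace ℝ (Fin 3) → EuclideanSpace ℝ (Fin 3) →L[ℝ] EuclideanSpace ℝ (Fin 3),
      (∀ r : ℝ, MemLp V 6 (volume.restrict (ball (0 : EuclideanSpace ℝ (Fin 3)) r))) ∧
      (∀ r : ℝ, MemLp G 2 (volume.restrict (ball (0 : EuclideanSpace ℝ (Fin 3)) r))) ∧
      (∀ r : ℝ, MemLp P (3 / 2 : ℝ≥0∞) (volume.restrict (ball (0 : EuclideanSpace ℝ (Fin 3)) r))) ∧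
      IsWeaklyDivFree V ∧
      HasWeakFDerivOn (⊤ : Opens (EuclideanSpace ℝ (Fin 3))) volume (selfSimilarBernoulli (1 / (2 + ρ)) 0 V P)
        (fun x => (2 * (1 / (2 + ρ)) - 1) • innerSL ℝ (selfSimilarTransport (1 / (2 + ρ)) 0 V x) +
          (innerSL ℝ (selfSimilarTransport (1 / (2 + ρ)) 0 V x)).comp (G x) -
          innerSL ℝ (G x (selfSimilarTransport (1 / (2 + ρ)) 0 V x))) ∧
      (∃ cA : ℝ, 0 ≤ cA ∧ ∀ L : ℝ, max (2 - T₁) 1 ≤ L →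
        ∫ x in ball (0 : EuclideanSpace ℝ (Fin 3)) L, ‖V x‖ ^ 2 ≤ cA * L ^ 3) := by
  have hA : ∀ a : ℝ, 0 < a → ENNReal.ofReal (a ^ (2 * ρ)) *
      cknA a (0 : ℝ × EuclideanSpace ℝ (Fin 3)) u ≤ (c : ℝ≥0∞) :=
    fun a ha => le_trans (le_trans le_self_add le_self_add) (hgauge a ha)
  have hE : ∀ a : ℝ, 0 < a → ENNReal.ofReal (a ^ ρ) *
      cknE a (0 : ℝ × EuclideanSpace ℝ (Fin 3)) H ≤ (c : ℝ≥0∞) :=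
    fun a ha => le_trans (le_trans le_add_self le_self_add) (hgauge a ha)
  have hD : ∀ a : ℝ, 0 < a → ENNReal.ofReal (a ^ (2 * ρ)) *
      cknD a (0 : ℝ × EuclideanSpace ℝ (Fin 3)) p ≤ (c : ℝ≥0∞) :=
    fun a ha => le_trans le_add_self (hgauge a ha)
  obtain ⟨G, hVm, hPm, -, hVG, -, ⟨CA, hCA, hAgr⟩, -, -, hV6, hG2, hP32, hdiv, heq, -, -⟩ :=
    Past.profileData_of_past hρ hρh hT₁ hTT₁ x₀ hsw.distributional hH hA hE hD hu hp
  refine ⟨G, hV6, hG2, hP32, hdiv, WeakBernoulli.hasWeakFDerivOn_bernoulli hV6 hVG hG2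
    (WeakPressure.hasWeakFDerivOn_pressure hVm hPm hV6 hVG hG2 hP32 hdiv heq), CA.toReal, ENNReal.toReal_nonneg, fun L hL => ?_⟩
  have hL1 : 1 ≤ L := le_trans (le_max_right _ _) hL
  haveI : IsFiniteMeasure ((volume : Measure (EuclideanSpace ℝ (Fin 3))).restrict (ball 0 L)) :=
    isFiniteMeasure_restrict.2 measure_ball_lt_top.ne
  have h1 : ∫⁻ y in ball (0 : EuclideanSpace ℝ (Fin 3)) L, ‖V y‖ₑ ^ 2 ≤ ENNReal.ofReal (CA.toReal * L ^ (1 - 2 * ρ)) := by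
    rw [ENNReal.ofReal_mul ENNReal.toReal_nonneg, ENNReal.ofReal_toReal hCA]
    exact hAgr L (le_trans (le_max_left _ _) hL)
  have h2 := setIntegral_norm_sq_le_of_lintegral_le (by positivity) ((hV6 L).mono_exponent (by norm_num)) h1
  refine h2.trans (mul_le_mul_of_nonneg_left ?_ ENNReal.toReal_nonneg)
  calc L ^ (1 - 2 * ρ) ≤ L ^ ((3 : ℕ) : ℝ) := Real.rpow_le_rpow_of_exponent_le hL1 (by push_cast; linarith)
    _ = L ^ 3 := Real.rpow_natCast L 3

/-! ## Member level: the renormalised law -/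

/-- **THE RENORMALISED BERNOULLI TRANSPORT LAW OF A PAST-EXACT SELF-SIMILAR CLASS MEMBER** (`0 < ρ ≤ ½`, `γ = 1/(2+ρ)`; NO
regularity of the profile).  Crux hypotheses verbatim (suitable weak Euler pair on the slab, weak spatial gradient, the three
power gauges), exact self-similarity about `(T, x₀)` with profile `(V, P)` for `τ < T₁` (`T₁ ≤ 0`, `T₁ ≤ T`).  Then for every
`β ∈ C¹(ℝ)` with `‖β′‖_∞ ≤ L` and every test function `θ`:
`∫ β(ℋ) ⟪W, ∇θ⟫ = −3γ ∫ θ β(ℋ) + (1 − 2γ) ∫ θ β′(ℋ) |W|²` (`W = selfSimilarTransport γ 0 V`, `ℋ = selfSimilarBernoulli γ 0 V P`).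
[folklore; cf. ConstantinIgnatovaVicol2026Putative §3.4.3 (3.31)] -/
theorem renormalized_transport_law_of_past {ρ : ℝ} (hρ : 0 < ρ) (hρh : ρ ≤ 1 / 2)
    {T T₁ : ℝ} (hT₁ : T₁ ≤ 0) (hTT₁ : T₁ ≤ T) (x₀ : EuclideanSpace ℝ (Fin 3))
    {u : ℝ → EuclideanSpace ℝ (Fin 3) → EuclideanSpace ℝ (Fin 3)} {p : ℝ → EuclideanSpace ℝ (Fin 3) → ℝ}
    {H : ℝ → EuclideanSpace ℝ (Fin 3) → EuclideanSpace ℝ (Fin 3) →L[ℝ] EuclideanSpace ℝ (Fin 3)} {c : ℝ≥0}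
    (hsw : IsSuitableWeakSolutionOn (slab (EuclideanSpace ℝ (Fin 3)) (Iio 0) isOpen_Iio) 0 0 u p)
    (hH : HasWeakSpatialGradientOn (slab (EuclideanSpace ℝ (Fin 3)) (Iio 0) isOpen_Iio) u H)
    (hgauge : ∀ a : ℝ, 0 < a →
      ENNReal.ofReal (a ^ (2 * ρ)) * cknA a (0 : ℝ × EuclideanSpace ℝ (Fin 3)) u +
          ENNReal.ofReal (a ^ ρ) * cknE a (0 : ℝ × EuclideanSpace ℝ (Fin 3)) H +
        ENNReal.ofReal (a ^ (2 * ρ)) * cknD a (0 : ℝ × EuclideanSpace ℝ (Fin 3)) p ≤ (c : ℝ≥0∞))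
    {V : EuclideanSpace ℝ (Fin 3) → EuclideanSpace ℝ (Fin 3)} {P : EuclideanSpace ℝ (Fin 3) → ℝ}
    (hu : ∀ τ : ℝ, τ < T₁ → u τ = fun x => selfSimilarCollapse (1 / (2 + ρ)) T V τ (x - x₀))
    (hp : ∀ τ : ℝ, τ < T₁ → p τ = fun x => selfSimilarCollapsePressure (1 / (2 + ρ)) T P τ (x - x₀))
    {β : ℝ → ℝ} (hβ : ContDiff ℝ 1 β) {L : ℝ} (hL : ∀ z, ‖deriv β z‖ ≤ L)
    {θ : EuclideanSpace ℝ (Fin 3) → ℝ} (hθ : IsTestFunctionOn (⊤ : Opens (EuclideanSpace ℝ (Fin 3))) θ) :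
    ∫ x, β (selfSimilarBernoulli (1 / (2 + ρ)) 0 V P x) * ⟪selfSimilarTransport (1 / (2 + ρ)) 0 V x, gradient θ x⟫ =
      -(3 * (1 / (2 + ρ))) * (∫ x, θ x * β (selfSimilarBernoulli (1 / (2 + ρ)) 0 V P x)) +
        (1 - 2 * (1 / (2 + ρ))) * ∫ x, θ x * (deriv β (selfSimilarBernoulli (1 / (2 + ρ)) 0 V P x) *
          ‖selfSimilarTransport (1 / (2 + ρ)) 0 V x‖ ^ 2) := by
  obtain ⟨G, hV6, hG2, hP32, hdiv, hHb, -⟩ := renormalizationData_of_past hρ hρh hT₁ hTT₁ x₀ hsw hH hgauge hu hp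
  exact renormalized_transport_law hV6 hG2 hP32 hdiv hHb hβ hL hθ

/-- **THE RENORMALISED BERNOULLI TRANSPORT LAW OF AN EXACTLY SELF-SIMILAR CLASS MEMBER (origin-centred; binder shape of the
skeleton's `IsExactlySelfSimilar`).**  Crux hypotheses verbatim, `0 < ρ ≤ ½`, `u(τ) = selfSimilarCollapse γ 0 V τ`,
`p(τ) = selfSimilarCollapsePressure γ 0 P τ` for `τ < 0`, `γ = 1/(2+ρ)`: for every `β ∈ C¹(ℝ)` with bounded derivative and every
test function `θ`, `∫ β(ℋ) ⟪W, ∇θ⟫ = −3γ ∫ θ β(ℋ) + (1 − 2γ) ∫ θ β′(ℋ) |W|²` — the Bernoulli function of a WEAK class profile is a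
RENORMALISED distributional solution of the similarity transport, no `C²` hypothesis. [folklore] -/
theorem renormalized_transport_law_of_selfSimilar {ρ : ℝ} (hρ : 0 < ρ) (hρh : ρ ≤ 1 / 2)
    {u : ℝ → EuclideanSpace ℝ (Fin 3) → EuclideanSpace ℝ (Fin 3)} {p : ℝ → EuclideanSpace ℝ (Fin 3) → ℝ}
    {H : ℝ → EuclideanSpace ℝ (Fin 3) → EuclideanSpace ℝ (Fin 3) →L[ℝ] EuclideanSpace ℝ (Fin 3)} {c : ℝ≥0}
    (hsw : IsSuitableWeakSolutionOn (slab (EuclideanSpace ℝ (Fin 3)) (Iio 0) isOpen_Iio) 0 0 u p)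
    (hH : HasWeakSpatialGradientOn (slab (EuclideanSpace ℝ (Fin 3)) (Iio 0) isOpen_Iio) u H)
    (hgauge : ∀ a : ℝ, 0 < a →
      ENNReal.ofReal (a ^ (2 * ρ)) * cknA a (0 : ℝ × EuclideanSpace ℝ (Fin 3)) u +
          ENNReal.ofReal (a ^ ρ) * cknE a (0 : ℝ × EuclideanSpace ℝ (Fin 3)) H +
        ENNReal.ofReal (a ^ (2 * ρ)) * cknD a (0 : ℝ × EuclideanSpace ℝ (Fin 3)) p ≤ (c : ℝ≥0∞))
    {V : EuclideanSpace ℝ (Fin 3) → EuclideanSpace ℝ (Fin 3)} {P : EuclideanSpace ℝ (Fin 3) → ℝ}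
    (hu : ∀ τ : ℝ, τ < 0 → u τ = selfSimilarCollapse (1 / (2 + ρ)) 0 V τ)
    (hp : ∀ τ : ℝ, τ < 0 → p τ = selfSimilarCollapsePressure (1 / (2 + ρ)) 0 P τ)
    {β : ℝ → ℝ} (hβ : ContDiff ℝ 1 β) {L : ℝ} (hL : ∀ z, ‖deriv β z‖ ≤ L)
    {θ : EuclideanSpace ℝ (Fin 3) → ℝ} (hθ : IsTestFunctionOn (⊤ : Opens (EuclideanSpace ℝ (Fin 3))) θ) :
    ∫ x, β (selfSimilarBernoulli (1 / (2 + ρ)) 0 V P x) * ⟪selfSimilarTransport (1 / (2 + ρ)) 0 V x, gradient θ x⟫ =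
      -(3 * (1 / (2 + ρ))) * (∫ x, θ x * β (selfSimilarBernoulli (1 / (2 + ρ)) 0 V P x)) +
        (1 - 2 * (1 / (2 + ρ))) * ∫ x, θ x * (deriv β (selfSimilarBernoulli (1 / (2 + ρ)) 0 V P x) *
          ‖selfSimilarTransport (1 / (2 + ρ)) 0 V x‖ ^ 2) := by
  have hu' : ∀ τ : ℝ, τ < 0 → u τ = fun x => selfSimilarCollapse (1 / (2 + ρ)) 0 V τ (x - 0) :=
    fun τ hτ => by rw [hu τ hτ]; funext x; rw [sub_zero]
  have hp' : ∀ τ : ℝ, τ < 0 → p τ = fun x => selfSimilarCollapsePressure (1 / (2 + ρ)) 0 P τ (x - 0) :=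
    fun τ hτ => by rw [hp τ hτ]; funext x; rw [sub_zero]
  exact renormalized_transport_law_of_past hρ hρh le_rfl le_rfl 0 hsw hH hgauge hu' hp' hβ hL hθ

/-! ## Member level: the high sets are backward-invariant -/

/-- **THE BERNOULLI HIGH SETS OF A PAST-EXACT SELF-SIMILAR CLASS MEMBER ARE BACKWARD-INVARIANT (Eulerian form).**  Crux
hypotheses verbatim (`0 < ρ ≤ ½`, `γ = 1/(2+ρ) < ½`), exact self-similarity about `(T, x₀)` for `τ < T₁`: for every level
`h` and every nonnegative test function `θ`, `−3γ ∫_{ℋ>h} θ ≤ ∫_{ℋ>h} ⟪W, ∇θ⟫` — `div(𝟙_{ℋ>h}W) ≤ 𝟙_{ℋ>h} div W` in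
`𝒟′(ℝ³)`, NO regularity of the profile. [folklore; cf. ConstantinIgnatovaVicol2026Putative §3.4.3 (3.31)–(3.33)] -/
theorem highSet_transport_ineq_of_past {ρ : ℝ} (hρ : 0 < ρ) (hρh : ρ ≤ 1 / 2)
    {T T₁ : ℝ} (hT₁ : T₁ ≤ 0) (hTT₁ : T₁ ≤ T) (x₀ : EuclideanSpace ℝ (Fin 3))
    {u : ℝ → EuclideanSpace ℝ (Fin 3) → EuclideanSpace ℝ (Fin 3)} {p : ℝ → EuclideanSpace ℝ (Fin 3) → ℝ}
    {H : ℝ → EuclideanSpace ℝ (Fin 3) → EuclideanSpace ℝ (Fin 3) →L[ℝ] EuclideanSpace ℝ (Fin 3)} {c : ℝ≥0}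
    (hsw : IsSuitableWeakSolutionOn (slab (EuclideanSpace ℝ (Fin 3)) (Iio 0) isOpen_Iio) 0 0 u p)
    (hH : HasWeakSpatialGradientOn (slab (EuclideanSpace ℝ (Fin 3)) (Iio 0) isOpen_Iio) u H)
    (hgauge : ∀ a : ℝ, 0 < a →
      ENNReal.ofReal (a ^ (2 * ρ)) * cknA a (0 : ℝ × EuclideanSpace ℝ (Fin 3)) u +
          ENNReal.ofReal (a ^ ρ) * cknE a (0 : ℝ × EuclideanSpace ℝ (Fin 3)) H +
        ENNReal.ofReal (a ^ (2 * ρ)) * cknD a (0 : ℝ × EuclideanSpace ℝ (Fin 3)) p ≤ (c : ℝ≥0∞))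
    {V : EuclideanSpace ℝ (Fin 3) → EuclideanSpace ℝ (Fin 3)} {P : EuclideanSpace ℝ (Fin 3) → ℝ}
    (hu : ∀ τ : ℝ, τ < T₁ → u τ = fun x => selfSimilarCollapse (1 / (2 + ρ)) T V τ (x - x₀))
    (hp : ∀ τ : ℝ, τ < T₁ → p τ = fun x => selfSimilarCollapsePressure (1 / (2 + ρ)) T P τ (x - x₀))
    (h : ℝ) {θ : EuclideanSpace ℝ (Fin 3) → ℝ} (hθ : IsTestFunctionOn (⊤ : Opens (EuclideanSpace ℝ (Fin 3))) θ)
    (hθ0 : ∀ x, 0 ≤ θ x) :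
    -(3 * (1 / (2 + ρ))) * (∫ x in {x | h < selfSimilarBernoulli (1 / (2 + ρ)) 0 V P x}, θ x) ≤
      ∫ x in {x | h < selfSimilarBernoulli (1 / (2 + ρ)) 0 V P x},
        ⟪selfSimilarTransport (1 / (2 + ρ)) 0 V x, gradient θ x⟫ := by
  have hγ : 1 / (2 + ρ) ≤ 1 / 2 := by
    rw [div_le_div_iff₀ (by linarith) (by norm_num)]; linarith
  obtain ⟨G, hV6, hG2, hP32, hdiv, hHb, -⟩ := renormalizationData_of_past hρ hρh hT₁ hTT₁ x₀ hsw hH hgauge hu hp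
  exact highSet_transport_ineq hγ hV6 hG2 hP32 hdiv hHb h hθ hθ0

/-- **THE BERNOULLI HIGH SETS OF AN EXACTLY SELF-SIMILAR CLASS MEMBER ARE BACKWARD-INVARIANT (origin-centred; binder shape of
the skeleton's `IsExactlySelfSimilar`).**  Crux hypotheses verbatim, `0 < ρ ≤ ½`, `u(τ) = selfSimilarCollapse γ 0 V τ`,
`p(τ) = selfSimilarCollapsePressure γ 0 P τ` for `τ < 0`: for every level `h` and every nonnegative test function `θ`,
`−3γ ∫_{ℋ>h} θ ≤ ∫_{ℋ>h} ⟪W, ∇θ⟫` — the Eulerian backward-invariance of every Bernoulli high set of the genuinely weak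
self-similar members of the stratum `stub_selfSimilarWeakRest`, with no flow and no regularity. [folklore] -/
theorem highSet_transport_ineq_of_selfSimilar {ρ : ℝ} (hρ : 0 < ρ) (hρh : ρ ≤ 1 / 2)
    {u : ℝ → EuclideanSpace ℝ (Fin 3) → EuclideanSpace ℝ (Fin 3)} {p : ℝ → EuclideanSpace ℝ (Fin 3) → ℝ}
    {H : ℝ → EuclideanSpace ℝ (Fin 3) → EuclideanSpace ℝ (Fin 3) →L[ℝ] EuclideanSpace ℝ (Fin 3)} {c : ℝ≥0}
    (hsw : IsSuitableWeakSolutionOn (slab (EuclideanSpace ℝ (Fin 3)) (Iio 0) isOpen_Iio) 0 0 u p)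
    (hH : HasWeakSpatialGradientOn (slab (EuclideanSpace ℝ (Fin 3)) (Iio 0) isOpen_Iio) u H)
    (hgauge : ∀ a : ℝ, 0 < a →
      ENNReal.ofReal (a ^ (2 * ρ)) * cknA a (0 : ℝ × EuclideanSpace ℝ (Fin 3)) u +
          ENNReal.ofReal (a ^ ρ) * cknE a (0 : ℝ × EuclideanSpace ℝ (Fin 3)) H +
        ENNReal.ofReal (a ^ (2 * ρ)) * cknD a (0 : ℝ × EuclideanSpace ℝ (Fin 3)) p ≤ (c : ℝ≥0∞))
    {V : EuclideanSpace ℝ (Fin 3) → EuclideanSpace ℝ (Fin 3)} {P : EuclideanSpace ℝ (Fin 3) → ℝ}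
    (hu : ∀ τ : ℝ, τ < 0 → u τ = selfSimilarCollapse (1 / (2 + ρ)) 0 V τ)
    (hp : ∀ τ : ℝ, τ < 0 → p τ = selfSimilarCollapsePressure (1 / (2 + ρ)) 0 P τ)
    (h : ℝ) {θ : EuclideanSpace ℝ (Fin 3) → ℝ} (hθ : IsTestFunctionOn (⊤ : Opens (EuclideanSpace ℝ (Fin 3))) θ)
    (hθ0 : ∀ x, 0 ≤ θ x) :
    -(3 * (1 / (2 + ρ))) * (∫ x in {x | h < selfSimilarBernoulli (1 / (2 + ρ)) 0 V P x}, θ x) ≤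
      ∫ x in {x | h < selfSimilarBernoulli (1 / (2 + ρ)) 0 V P x},
        ⟪selfSimilarTransport (1 / (2 + ρ)) 0 V x, gradient θ x⟫ := by
  have hu' : ∀ τ : ℝ, τ < 0 → u τ = fun x => selfSimilarCollapse (1 / (2 + ρ)) 0 V τ (x - 0) :=
    fun τ hτ => by rw [hu τ hτ]; funext x; rw [sub_zero]
  have hp' : ∀ τ : ℝ, τ < 0 → p τ = fun x => selfSimilarCollapsePressure (1 / (2 + ρ)) 0 P τ (x - 0) :=
    fun τ hτ => by rw [hp τ hτ]; funext x; rw [sub_zero]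
  exact highSet_transport_ineq_of_past hρ hρh le_rfl le_rfl 0 hsw hH hgauge hu' hp' h hθ hθ0

end WeakRenormalized

end Summit.NavierStokesRegularity.NavierStokesRegularity.Theorems.PowerGaugeEulerLiouville
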